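import Summits.QuantumFields.YangMills.Theorems.SwapVirialDeficitBlowUpScaling
import Summits.QuantumFields.YangMills.Theorems.SwapVirialDeficitBlowUpDominator
import Summits.QuantumFields.YangMills.Theorems.SwapVirialDeficitBlowUpLimitShellAE
import Summits.QuantumFields.YangMills.Theorems.SwapVirialDeficitSwapRingLogFreeFloor
import Summits.QuantumFields.YangMills.Theorems.SwapVirialDeficitSwapRingMeanActionFixedLLimit
import Summits.QuantumFields.YangMills.Theorems.SwapVirialDeficitSwapRingCeilingLaplace
import HarnessLib

/-!
# The MASSIVE-MODE RUNG at fixed `L`, assembled MODULO THE POINTWISE BLOW-UP (P) (bricks J4-glue + J6 of memo-24197-massive-mode-rung):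
# (D″) for the blow-up event of the scaling identity, and `principal_smallBall_limit_of_hP`
# (free-hands support of ⟨stmt-QuantumFields-24197⟩ `SwapVirialDeficit.SwapGluedStiffness`)

With the scaling identity (S) ✓`BlowUpRing.ringMeasure_swapDeficit_le_eq_scaling_rpow` (`κ = coneConst^{6L⁴}`, `α = 9L⁴ − 1`,
`β = cone ⊗ (vol³ ⊗ vol^{Fol})`, `E r u = blowUpSet L 0 1 (√u) (r·u)`), this file supplies the remaining MEASURE-THEORETIC hypotheses of the shell
✓`BlowUp.smallBall_limit_real_of_blowUp_of_weight_ae` in the principal sector and assembles the rung modulo the pointwise input (P):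

* §1 `ae_followers_ne_zero` — `β`-a.e. every follower coordinate is non-zero (`Measure.ae_eval_ne`);
* §2 ★★ `hD_blowUpSet` — (D″): for every `r > 0`, fcl-p3 g45's ✓`dominatorWeight R K` with `R = 60L³√r/√2`, `K = 48L³√r` has finite `β`-integral
  (✓`lintegral_dominatorWeight_ne_top`) and dominates `E r u` for EVERY `u > 0`, `β`-a.e. (✓`ae_one_le_dominatorWeight` fed by the box in chart coordinates
  ✓`chartBox_of_chartDeficit`, the Frobenius ∕ quaternion bridge ✓`swapCommSet_subset_quat`, `√(r·u) = √r·√u`);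
* §3 ★★★ `principal_smallBall_limit_of_hP` — GIVEN ONLY the pointwise blow-up (P) for `blowUpSet` (a measurable `G`, a measurable `Dom₀`, and
  `β`-a.e. `∀ r > 0, G x ≠ r → ∀ᶠ u → 0⁺, (x ∈ E r u ↔ x ∈ Dom₀ ∧ G x < r)` — the shape of w3 g64's ✓`BlowUp.ae_shell_hP`):
  `∃ v > 0, μ_L.real{F^S_0 ≤ u} / u^{9L⁴−1} → v` as `u → 0⁺` ((S) + (D″) + the floor ✓`SwapRing.swap_volume_floor` in the shell);
* §4 ★★ `tendsto_meanAction_fixedL_of_hP`, ★★ `swap_stiffness_fixedL_of_hP` — the fixed-`L` rows of ⟨24197⟩ modulo (P), by ✓`tendsto_meanAction_of_principalLimit` ∕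
  ✓`swap_stiffness_fixedL_of_principalLimit`: `b·(log Z^S(L,·,2L))′(b) − 12bL⁴ → −(9L⁴ − 1)` and the stiffness sandwich with any `c < 1/2`.

HONEST LABEL: the massive-mode rung is NOT proved here — it is reduced, by name, to the pointwise blow-up statement (P) for `blowUpSet` (J5: smoothness of
`t ↦ chartDeficit (blowUpPoint t x)` via fcl-p3 g45's quaternion deficit + w3 g64's letter paths, flatness at `t = 0` on `Dom₀`); ⟨24197⟩ ∕ ⟨24194⟩ ∕ ⟨24497⟩
(window-uniform) stay OPEN; no crux, rung or summit is proved; the Yang–Mills mass gap is NOT proved; no summit is proved by a line.  THEOREMS ONLY (0 `def`,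
0 `sorry`), standard axioms; the series' local `ℍ` instances.  Width seat ym-line-sfw-p2-w2 g57 (cell ym-idea-1, free hands), `--supports stmt-QuantumFields-24197`.
References: [cite: tHooft1979]; [cite: Luscher1983, §2]; [folklore].
-/

set_option autoImplicit false

noncomputable section

open MeasureTheory Quaternion Set Filter Topology
open scoped Quaternion ENNReal BigOperators
open Literature.MathematicalPhysics.QuantumLattice
open Literature.MathematicalPhysics.QuantumFieldTheory hiding SU2
open Summit.QuantumFields.YangMills.Theorems.SwapTwistDeficit.ToronLog

attribute [local instance] Literature.Analysis.FluidPDE.Tao2016.quatMeasurableSpace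
  Literature.Analysis.FluidPDE.Tao2016.quatBorelSpace
  Literature.MathematicalPhysics.QuantumLattice.secondCountableTopology_su2

namespace Summit.QuantumFields.YangMills.Theorems.SwapVirialDeficit.BlowUpRing

open Summit.QuantumFields.YangMills.Theorems.FemtoTransferGap
open Summit.QuantumFields.YangMills.Theorems.FemtoTransferGap.TT
open Summit.QuantumFields.YangMills.Theorems.VirialFluxGap.RingDeficit
open Summit.QuantumFields.YangMills.Theorems.SwapVirialDeficit.SwapRing
open Summit.QuantumFields.YangMills.Theorems.SwapVirialDeficit.ZeroModeSigma (dil3 dil3_apply measurable_dil3 ball3 measurableSet_ball3 dilateIm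
  continuous_dilateIm sigmaBall vol3 vol3_def sFinite_vol3)
open Summit.QuantumFields.YangMills.Theorems.SwapVirialDeficit.BlowUp (leaderTuple dominatorWeight lintegral_dominatorWeight_ne_top ae_one_le_dominatorWeight
  dilateIm_dilateIm dilateIm_one_apply smallBall_limit_real_of_blowUp_of_weight_ae)

variable {L : ℕ} [NeZero L]

/-! ## §1 Null sets of the blow-up space -/

/-- `vol³` is the Lebesgue measure of `(ℍ × ℍ) × ℍ` (definitional). [folklore] -/
theorem vol3_eq_volume : vol3 = (volume : Measure ((ℍ × ℍ) × ℍ)) := rfl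

/-- `β`-a.e. every follower coordinate is non-zero. [folklore] -/
theorem ae_followers_ne_zero :
    ∀ᵐ x : ℍ × (((ℍ × ℍ) × ℍ) × (Fol L → ℍ)) ∂(coneMeasure.prod ((volume : Measure ((ℍ × ℍ) × ℍ)).prod
      (Measure.pi fun _ : Fol L => (volume : Measure ℍ)))), ∀ i, x.2.2 i ≠ 0 := by
  haveI := isProbabilityMeasure_coneMeasure
  have hy : ∀ᵐ y : Fol L → ℍ ∂(Measure.pi fun _ : Fol L => (volume : Measure ℍ)), ∀ i, y i ≠ 0 :=
    ae_all_iff.2 fun i => Measure.ae_eval_ne (fun _ : Fol L => (volume : Measure ℍ)) i 0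
  have h2 := (Measure.quasiMeasurePreserving_snd (μ := (volume : Measure ((ℍ × ℍ) × ℍ)))
    (ν := Measure.pi fun _ : Fol L => (volume : Measure ℍ))).ae hy
  exact (Measure.quasiMeasurePreserving_snd (μ := coneMeasure)
    (ν := (volume : Measure ((ℍ × ℍ) × ℍ)).prod (Measure.pi fun _ : Fol L => (volume : Measure ℍ)))).ae h2

/-- A non-zero quaternion stays non-zero under the imaginary dilation `D³_t`, `t ≠ 0`. [folklore] -/
theorem dilateIm_ne_zero {t : ℝ} (ht : t ≠ 0) {y : ℍ} (hy : y ≠ 0) : dilateIm t y ≠ 0 := by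
  intro h
  apply hy
  have h' : dilateIm t⁻¹ (dilateIm t y) = y := by rw [dilateIm_dilateIm, inv_mul_cancel₀ ht, dilateIm_one_apply]
  rw [← h', h, map_zero]

/-! ## §2 (D″): the dominator of the blow-up event in the principal sector -/

/-- ★★ **(D″) FOR THE BLOW-UP EVENT OF (S)**, principal sector: for every `r > 0` the weight `Φ_r = dominatorWeight (60L³√r/√2) (48L³√r)` has finite
`β`-integral and, for EVERY `u > 0`, `β`-a.e. `x ∈ E r u → 1 ≤ Φ_r x` (at `F ≤ r·u` the box ✓`chartBox_of_chartDeficit` puts the leaders into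
`sigmaBall (R·√u)` — Frobenius `60L³√(ru)` is quaternion `60L³√r·√u/√2`, ✓`swapCommSet_subset_quat` — and every follower within `48L³√r·√u` of `1`).
[cite: Luscher1983, §2] [cite: tHooft1979] -/
theorem hD_blowUpSet (L : ℕ) [NeZero L] {r : ℝ} (hr : 0 < r) :
    ∃ Φ : ℍ × (((ℍ × ℍ) × ℍ) × (Fol L → ℍ)) → ℝ≥0∞,
      ∫⁻ x, Φ x ∂(coneMeasure.prod ((volume : Measure ((ℍ × ℍ) × ℍ)).prod (Measure.pi fun _ : Fol L => (volume : Measure ℍ)))) ≠ ∞ ∧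
      ∀ᶠ u in 𝓝[>] (0 : ℝ), ∀ᵐ x ∂(coneMeasure.prod ((volume : Measure ((ℍ × ℍ) × ℍ)).prod (Measure.pi fun _ : Fol L => (volume : Measure ℍ)))),
        x ∈ blowUpSet L (fun _ => false) (fun _ => 1) (Real.sqrt u) (r * u) → 1 ≤ Φ x := by
  set R : ℝ := 60 * (L : ℝ) ^ 3 * Real.sqrt r / Real.sqrt 2 with hR
  set K : ℝ := 48 * (L : ℝ) ^ 3 * Real.sqrt r with hK
  have hL : (0 : ℝ) < L := by exact_mod_cast NeZero.pos L
  have hsr : 0 < Real.sqrt r := Real.sqrt_pos.2 hr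
  have hs2 : 0 < Real.sqrt 2 := Real.sqrt_pos.2 (by norm_num)
  have hR0 : 0 < R := by positivity
  have hK0 : 0 ≤ K := by positivity
  refine ⟨dominatorWeight (ι := Fol L) R K, ?_, ?_⟩
  · rw [← vol3_eq_volume]; exact lintegral_dominatorWeight_ne_top hR0 K
  · have hae := ae_one_le_dominatorWeight (ι := Fol L) hR0 hK0
    rw [vol3_eq_volume] at hae
    filter_upwards [self_mem_nhdsWithin] with u hu
    have hu0 : (0 : ℝ) < u := hu
    have ht : 0 < Real.sqrt u := Real.sqrt_pos.2 hu0
    filter_upwards [hae, ae_followers_ne_zero (L := L)] with x hx hne hmem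
    obtain ⟨hball, hfol, hdef⟩ := hmem
    obtain ⟨hCC, hcC, hU⟩ := chartBox_of_chartDeficit (L := L) (blowUpPoint (Real.sqrt u) x)
    -- `60L³√(F) ≤ 60L³√(r u) = (60L³√r)·√u`
    have hδ : Real.sqrt (chartDeficit L (fun _ => false) (fun _ => 1) (blowUpPoint (Real.sqrt u) x)) ≤ Real.sqrt r * Real.sqrt u := by
      rw [← Real.sqrt_mul hr.le]; exact Real.sqrt_le_sqrt hdef
    have h60 : 60 * (L : ℝ) ^ 3 * Real.sqrt (chartDeficit L (fun _ => false) (fun _ => 1) (blowUpPoint (Real.sqrt u) x)) ≤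
        60 * (L : ℝ) ^ 3 * Real.sqrt r * Real.sqrt u := by
      rw [mul_assoc (60 * (L : ℝ) ^ 3)]; exact mul_le_mul_of_nonneg_left hδ (by positivity)
    have h48 : 48 * (L : ℝ) ^ 3 * Real.sqrt (chartDeficit L (fun _ => false) (fun _ => 1) (blowUpPoint (Real.sqrt u) x)) ≤ K * Real.sqrt u := by
      rw [hK, mul_assoc (48 * (L : ℝ) ^ 3)]; exact mul_le_mul_of_nonneg_left hδ (by positivity)
    refine hx (Real.sqrt u) ht ?_ hball fun i => ⟨hfol i, dilateIm_ne_zero ht.ne' (hne i), (hU i).trans h48⟩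
    -- leaders: Frobenius box at `60L³√r·√u` ⟹ quaternion relations at `R·√u`
    have hq := swapCommSet_subset_quat (60 * (L : ℝ) ^ 3 * Real.sqrt r * Real.sqrt u)
      (show (blowUpPoint (Real.sqrt u) x).1 ∈ _ from ⟨fun μ ν => (hCC μ ν).trans h60, fun μ => (hcC μ).trans h60⟩)
    have hRt : 60 * (L : ℝ) ^ 3 * Real.sqrt r * Real.sqrt u / Real.sqrt 2 = R * Real.sqrt u := by rw [hR]; ring
    rw [Set.mem_setOf_eq, hRt] at hq
    exact hq

/-! ## §3 The principal small-ball limit modulo the pointwise blow-up (P) -/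

/-- ★★★ **THE MASSIVE-MODE RUNG MODULO (P)**: if the blow-up event `E r u = blowUpSet L 0 1 (√u) (r·u)` of the scaling identity converges POINTWISE —
a measurable `G` and a measurable `Dom₀` with, `β`-a.e., `∀ r > 0, G x ≠ r → ∀ᶠ u → 0⁺, (x ∈ E r u ↔ x ∈ Dom₀ ∧ G x < r)` — then
`∃ v > 0, μ_L.real{F^S_0 ≤ u} / u^{9L⁴−1} → v` (`u → 0⁺`): (S) ✓`ringMeasure_swapDeficit_le_eq_scaling_rpow` + (D″) `hD_blowUpSet` + the floor
✓`swap_volume_floor` in ✓`smallBall_limit_real_of_blowUp_of_weight_ae`. [cite: tHooft1979] [cite: Luscher1983, §2] -/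
theorem principal_smallBall_limit_of_hP (L : ℕ) [NeZero L] {G : ℍ × (((ℍ × ℍ) × ℍ) × (Fol L → ℍ)) → ℝ} (hG : Measurable G)
    {Dom₀ : Set (ℍ × (((ℍ × ℍ) × ℍ) × (Fol L → ℍ)))} (hDom : MeasurableSet Dom₀)
    (hP : ∀ᵐ x ∂(coneMeasure.prod ((volume : Measure ((ℍ × ℍ) × ℍ)).prod (Measure.pi fun _ : Fol L => (volume : Measure ℍ)))),
      ∀ r : ℝ, 0 < r → G x ≠ r → ∀ᶠ u in 𝓝[>] (0 : ℝ),
        (x ∈ blowUpSet L (fun _ => false) (fun _ => 1) (Real.sqrt u) (r * u) ↔ (x ∈ Dom₀ ∧ G x < r))) :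
    ∃ v : ℝ, 0 < v ∧ Tendsto (fun u : ℝ => (ringMeasure L).real {P | swapRingDeficit L (fun _ => false) P ≤ u} / u ^ (9 * L ^ 4 - 1))
      (𝓝[>] (0 : ℝ)) (𝓝 v) := by
  haveI := isProbabilityMeasure_coneMeasure
  haveI : SigmaFinite (Measure.pi fun _ : Fol L => (volume : Measure ℍ)) := by infer_instance
  haveI : SFinite ((volume : Measure ((ℍ × ℍ) × ℍ)).prod (Measure.pi fun _ : Fol L => (volume : Measure ℍ))) := by infer_instance
  haveI : SFinite (coneMeasure.prod ((volume : Measure ((ℍ × ℍ) × ℍ)).prod (Measure.pi fun _ : Fol L => (volume : Measure ℍ)))) := by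
    infer_instance
  have hχ : ∀ (x : Site 3 L) (k : SU2), k * (fun _ : Site 3 L => (1 : SU2)) x = (fun _ : Site 3 L => (1 : SU2)) x * k := fun x k => by
    simp only [mul_one, one_mul]
  obtain ⟨c, hc, u₀, hu₀, hfloor⟩ := swap_volume_floor L
  have hfloor' : ∀ u : ℝ, 0 < u → u ≤ u₀ → c * u ^ (((9 * L ^ 4 - 1 : ℕ) : ℝ)) ≤
      (ringMeasure L).real {P | swapRingDeficit L (fun _ => false) P ≤ u} := fun u hu hu' => by
    rw [Real.rpow_natCast]; exact hfloor u hu hu'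
  have h := smallBall_limit_real_of_blowUp_of_weight_ae (ringMeasure L) (F := swapRingDeficit L (fun _ => false))
    (α := ((9 * L ^ 4 - 1 : ℕ) : ℝ)) (κ := coneConst ^ (6 * L ^ 4)) (coneConst_pow_nonneg _)
    (coneMeasure.prod ((volume : Measure ((ℍ × ℍ) × ℍ)).prod (Measure.pi fun _ : Fol L => (volume : Measure ℍ))))
    (E := fun r u => blowUpSet L (fun _ => false) (fun _ => 1) (Real.sqrt u) (r * u))
    (fun r u => measurableSet_blowUpSet _ _ _ _)
    (fun r u _ hu => ringMeasure_swapDeficit_le_eq_scaling_rpow (fun _ => false) hχ r u hu)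
    (fun r hr => hD_blowUpSet L hr) hG hDom hP hc hu₀ hfloor'
  simpa only [Real.rpow_natCast] using h

/-! ## §4 The fixed-`L` rows of ⟨24197⟩ modulo (P) -/

/-- ★★ **The σ-glued mean action at fixed `L`, modulo (P)**: `b·(log Z^S(L,·,2L))′(b) − 12bL⁴ → −(9L⁴ − 1)` (✓`tendsto_meanAction_of_principalLimit`).
[cite: tHooft1979] [cite: Luscher1983, §2] -/
theorem tendsto_meanAction_fixedL_of_hP (L : ℕ) [NeZero L] {G : ℍ × (((ℍ × ℍ) × ℍ) × (Fol L → ℍ)) → ℝ} (hG : Measurable G)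
    {Dom₀ : Set (ℍ × (((ℍ × ℍ) × ℍ) × (Fol L → ℍ)))} (hDom : MeasurableSet Dom₀)
    (hP : ∀ᵐ x ∂(coneMeasure.prod ((volume : Measure ((ℍ × ℍ) × ℍ)).prod (Measure.pi fun _ : Fol L => (volume : Measure ℍ)))),
      ∀ r : ℝ, 0 < r → G x ≠ r → ∀ᶠ u in 𝓝[>] (0 : ℝ),
        (x ∈ blowUpSet L (fun _ => false) (fun _ => 1) (Real.sqrt u) (r * u) ↔ (x ∈ Dom₀ ∧ G x < r))) :
    Tendsto (fun b : ℝ => b * deriv (fun x : ℝ => Real.log (TT.twistTrace L x (2 * L))) b - 12 * b * (L : ℝ) ^ 4) atTop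
      (𝓝 (-(9 * (L : ℝ) ^ 4 - 1))) := by
  obtain ⟨v, hv, hlim⟩ := principal_smallBall_limit_of_hP L hG hDom hP
  exact tendsto_meanAction_of_principalLimit L hv hlim

/-- ★★ **The fixed-`L` stiffness sandwich, modulo (P)**: for every `ε > 0`, eventually
`12bL⁴ − 9L⁴ + 1 − ε ≤ b·(log Z^S)′(b) ≤ 12bL⁴ − 9L⁴ + 3/2 − (1/2 − ε)` (✓`swap_stiffness_fixedL_of_principalLimit`). [cite: tHooft1979] [cite: Luscher1983, §2] -/
theorem swap_stiffness_fixedL_of_hP (L : ℕ) [NeZero L] {G : ℍ × (((ℍ × ℍ) × ℍ) × (Fol L → ℍ)) → ℝ} (hG : Measurable G)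
    {Dom₀ : Set (ℍ × (((ℍ × ℍ) × ℍ) × (Fol L → ℍ)))} (hDom : MeasurableSet Dom₀)
    (hP : ∀ᵐ x ∂(coneMeasure.prod ((volume : Measure ((ℍ × ℍ) × ℍ)).prod (Measure.pi fun _ : Fol L => (volume : Measure ℍ)))),
      ∀ r : ℝ, 0 < r → G x ≠ r → ∀ᶠ u in 𝓝[>] (0 : ℝ),
        (x ∈ blowUpSet L (fun _ => false) (fun _ => 1) (Real.sqrt u) (r * u) ↔ (x ∈ Dom₀ ∧ G x < r)))
    {ε : ℝ} (hε : 0 < ε) :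
    ∃ β₃ : ℝ, ∀ b : ℝ, β₃ ≤ b →
      b * deriv (fun x : ℝ => Real.log (TT.twistTrace L x (2 * L))) b ≤
          12 * b * (L : ℝ) ^ 4 - 9 * (L : ℝ) ^ 4 + 3 / 2 - (1 / 2 - ε) ∧
      12 * b * (L : ℝ) ^ 4 - 9 * (L : ℝ) ^ 4 + 1 - ε ≤ b * deriv (fun x : ℝ => Real.log (TT.twistTrace L x (2 * L))) b := by
  obtain ⟨v, hv, hlim⟩ := principal_smallBall_limit_of_hP L hG hDom hP
  exact swap_stiffness_fixedL_of_principalLimit L hv hlim hε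

end Summit.QuantumFields.YangMills.Theorems.SwapVirialDeficit.BlowUpRing

end
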